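import Summits.ABC.ABC.Theses.CubicResolventAllowance
import HarnessLib

/-!
# stub-ideation k2 (RESHAPE) — generation 10 sketch for `stub_complexCubic` (crux `IndexSzpiro`, stmt-ABC-22740)

Companion to `STUB-IDEAS-stub_complexCubic-2.md` (gen 10).  Gens 7–9 of this slot
(`StubIdeas2G7Sketch.lean`, `StubIdeas2G8Sketch.lean`, `StubIdeas2G9Sketch.lean`, same directory; G9 re-checked
rc 0 on 2026-08-31) are carried BY REFERENCE.  This file only TYPES what gen 10 adds: the DISCRIMINANT-EXPONENT
DIAL of uniform abc over the 2-division field `L = ℚ(E[2])` (an `S₃`-sextic for every member of the complex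
class, since `d_K < 0` excludes cyclic cubic resolvent fields), on which

* Szpiro `6+ε` on the class sits at exponent `A = 1 + ε` (von Känel 2014, Prop. 4.2 / Thm 3.5 (iii)),
* the stub (`IndexSzpiro ∧ d_K < 0`) sits at `A = 4/3`: at a multiplicative prime `p ≥ 5` with ODD `n_p = v_p(Δ_min)`
  one has `e_p(L) = 2`, `v_p(d_L) = 3`, `∏_{𝔭 ∣ p} N𝔭 = p³`, so `|d_L|^A · N_L` contributes `p^{3A+3}` = `p⁷ = p · p⁶`
  exactly when `A = 4/3` — the allowance `|d_K|` (one free unit per odd tower, k3-G8 `padicValNat_discr_eq_mod_two`)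
  is worth `1/3` in Masser's discriminant exponent; at EVEN towers `e_p = 1`, `v_p(d_L) = 0`, `∏ N𝔭 = p⁶` for every `A`.

Nothing here is progress on the stub: every notch `A < ∞` of the dial is open (even for ONE field `L`,
`Literature.StrongHypotheses.ABC.NumberFieldABCConjecture`), and `A < 1` without `ε` is refuted in general
(`Literature.Barriers.ABC.UniformABCDiscriminantSharp`, Masser 2002).  Bodies are `sorry` unless short.
-/

open Polynomial

set_option linter.dupNamespace false

namespace Summit.ABC.ABC.Cruxes.IndexSzpiro.StubIdeas2G10

open Literature.NumberTheory.DiophantineGeometry (UniformABCConjecture radicalNorm)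

/-! ## §0  The stub (verbatim) and Szpiro-without-allowance on the same class -/

/-- `stub_complexCubic`, verbatim (registered signature, skeleton sha d34fb8f2…). -/
def Stub : Prop :=
  ∀ ε : ℝ, 0 < ε → ∃ C : ℝ, ∀ (W : WeierstrassCurve ℚ) [W.IsElliptic] (K : Type) [Field K] [NumberField K],
    Irreducible W.twoTorsionPolynomial.toPoly → Module.finrank ℚ K = 3 →
    (∃ θ : K, aeval θ W.twoTorsionPolynomial.toPoly = 0) → NumberField.discr K < 0 →
    (W.minimalDiscriminantNorm ℤ : ℝ) ≤ C * |(NumberField.discr K : ℝ)| * (W.conductorNorm ℤ : ℝ) ^ (6 + ε)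

/-- Szpiro `6+ε` on the complex `r = 0` class, WITHOUT the allowance (gen-9 `PolySzpiroOnComplexClass`, `∀ε` form). -/
def SzpiroOnComplexClass : Prop :=
  ∀ ε : ℝ, 0 < ε → ∃ C : ℝ, ∀ (W : WeierstrassCurve ℚ) [W.IsElliptic] (K : Type) [Field K] [NumberField K],
    Irreducible W.twoTorsionPolynomial.toPoly → Module.finrank ℚ K = 3 →
    (∃ θ : K, aeval θ W.twoTorsionPolynomial.toPoly = 0) → NumberField.discr K < 0 →
    (W.minimalDiscriminantNorm ℤ : ℝ) ≤ C * (W.conductorNorm ℤ : ℝ) ^ (6 + ε)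

/-! ## §1  The dial: uniform abc over sextic number fields with discriminant exponent `A` -/

/-- `UABC₆(A)`: for every `ε > 0` one constant `C` serves ALL number fields `L` of degree `6` and all nonzero
`a + b = c` in `L`: `H_L(a:b:c) < C · |d_L|^A · N_L(a,b,c)^{1+ε}` (relative height `Height.mulHeight`, Granville–Stark
conductor `radicalNorm`, as in the tree's `UniformABCConjecture`, which is the case "`A = 1+ε`, all degrees,
`C ↦ C^{[L:ℚ]}`").  Larger `A` = weaker statement. -/
def UABCSexticDiscExp (A : ℝ) : Prop :=
  ∀ ε : ℝ, 0 < ε → ∃ C : ℝ, ∀ (L : Type) [Field L] [NumberField L] (a b c : L),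
    Module.finrank ℚ L = 6 → a ≠ 0 → b ≠ 0 → c ≠ 0 → a + b = c →
      Height.mulHeight ![a, b, c] < C * |(NumberField.discr L : ℝ)| ^ A * (radicalNorm a b c : ℝ) ^ (1 + ε)

/-- **T1 (S).** Every notch `A > 1` of the dial follows from Granville–Stark's uniform abc (take `ε' = min ε (A-1)`,
`|d_L| ≥ 1`, `N_L ≥ 1`, constant `C^6`). -/
theorem T1_dial_of_uniformABC {A : ℝ} (hA : 1 < A) : UniformABCConjecture → UABCSexticDiscExp A := by
  sorry

/-- **T2 (S).** The dial is monotone (`|d_L| ≥ 1`: `NumberField.discr_ne_zero`, `Real.rpow_le_rpow_of_exponent_le`). -/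
theorem T2_dial_mono {A B : ℝ} (hAB : A ≤ B) : UABCSexticDiscExp A → UABCSexticDiscExp B := by
  sorry

/-- **T3 (L; CONDITIONAL CALIBRATION, not progress).** The notch `A = 4/3` already gives the stub: apply `UABC₆(4/3)` in
`L = ℚ(E[2])` (degree 6 because `d_K < 0`) to `λ + (1-λ) = 1`, `λ = (e₃-e₁)/(e₂-e₁)`; then
`log den j(E) ≤ h(j) ≤ 6 h(λ) + O(1)·6` (tree `exists_abs_logHeight₁_jLambda_sub_le_finrank`), `Δ_min ∣ den(j)·(bounded)·∏_{Iₙ*} p⁶`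
(k3 L3b/L4, k1-G3 `minimalDiscriminantNorm_dvd_den_j_mul`), and the local table of the module docstring
(`e_p(L) = 2 ↔ Odd n_p` at multiplicative `p ≥ 5`, tame `v_p(𝔡_L) = 6 - Σ f_𝔭`) turns `|d_L|^{4/3} N_L^{1+ε}` into
`≤ C' · |d_K| · N^{6+6ε}`.  Pieces still untyped in the tree: `λ ∈ ℚ(E[2])` with `j(W) = j(λ)`; the tame different formula. -/
theorem T3_stub_of_dial_fourThirds : UABCSexticDiscExp (4 / 3) → Stub := by
  sorry

/-- **T4 (L; = von Känel 2014 Prop. 4.2 restricted to the class).** The notches `A ↓ 1` give Szpiro `6+ε` itself on the class. -/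
theorem T4_szpiroOnComplexClass_of_dial (h : ∀ A : ℝ, 1 < A → UABCSexticDiscExp A) : SzpiroOnComplexClass := by
  sorry

/-- **T5 (S, proved).** Szpiro on the class gives the stub (`|d_K| ≥ 1`); with T3/T4 the stub is pinned on the dial
between `A = 1+ε` (Szpiro) and `A = 4/3`. -/
theorem T5_stub_of_szpiroOnComplexClass : SzpiroOnComplexClass → Stub := by
  intro h ε hε
  obtain ⟨C, hC⟩ := h ε hε
  refine ⟨max C 0, ?_⟩
  intro W _ K _ _ hirr hrk hθ hd
  have h1 := hC W K hirr hrk hθ hd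
  have hN : (0 : ℝ) ≤ (W.conductorNorm ℤ : ℝ) ^ (6 + ε) := by positivity
  have hdisc : (1 : ℝ) ≤ |(NumberField.discr K : ℝ)| := by
    have h0 : NumberField.discr K ≠ 0 := NumberField.discr_ne_zero K
    have : (1 : ℤ) ≤ |NumberField.discr K| := Int.one_le_abs h0
    exact_mod_cast this
  calc (W.minimalDiscriminantNorm ℤ : ℝ) ≤ C * (W.conductorNorm ℤ : ℝ) ^ (6 + ε) := h1
    _ ≤ max C 0 * (W.conductorNorm ℤ : ℝ) ^ (6 + ε) :=
        mul_le_mul_of_nonneg_right (le_max_left _ _) hN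
    _ = max C 0 * 1 * (W.conductorNorm ℤ : ℝ) ^ (6 + ε) := by ring
    _ ≤ max C 0 * |(NumberField.discr K : ℝ)| * (W.conductorNorm ℤ : ℝ) ^ (6 + ε) := by
        apply mul_le_mul_of_nonneg_right _ hN
        exact mul_le_mul_of_nonneg_left hdisc (le_max_right _ _)

end Summit.ABC.ABC.Cruxes.IndexSzpiro.StubIdeas2G10
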